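import Summits.CriticalPhenomena.PercolationContinuityZ3.Theorems.PercNearOneGluingNoHeavyQuantFarGate3Law
import HarnessLib

/-!
# QUANT lane R8, front "FAR beyond trees", layer one — **THE DEGREE-THREE GATE AT THE OBSERVER, IV: FAR(1) IN THE COUPLED REGIME**

builds on p205010 (kernel theorem, internal audit signed; external expert review pending)

Support file (`--supports stmt-CriticalPhenomena-4575`), seat `prim-quant-p1` (gen 28); memo
`run/shared/lean/prim/quant/prim-quant-p1-g28/FOR-LEAD-GATE3.md` §3.  Standard axioms; no sorries; no definitions.

**THEOREM (`Quant.farLayerOne_of_gate3_coupled`).**  Let `w` be any weight function on the pairs of `Fin n`, `A` a relay set, `o` the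
observer, and let `v ∈ A` be a relay whose positive pairs are exactly `s(o,v)` (weight `p`), `s(v,u₁)` (weight `r₁`) and `s(v,u₂)`
(weight `r₂`) towards two further relays `u₁, u₂ ∈ A` (arbitrary further pairs; `o, v, u₁, u₂` distinct) — a degree-three gate at the
observer.  If the gate is COUPLED, `(1 − p)² ≤ (p + (1 − p)r₁)(p + (1 − p)r₂)` (e.g. `p ≥ 1/2`, `Quant.farLayerOne_of_gate3_half`), then
`P(#{a ∈ A : o ↔ a} ≤ 1) ≤ max(P(o ↮ u₁), P(o ↮ u₂))`; in particular the layer-one instance of the far-relay row `Quant.FarRelayRow`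
holds at `(w, A, o)` — here even WITHOUT its mean hypothesis (`Quant.farLayerOne_of_gate3_coupled'`).

Proof: on a good configuration at most one relay is joined to `o` only if at most one of `v, u₁, u₂` is (file I); integrating over
the eight states of the three pairs (files II–III) bounds `P(N ≤ 1)` by a combination `U` of the off-`v` events `¬G₁∧¬G₂`, `¬G₁`, `¬G₂`,
`¬(G₁∧G₂)` and expresses the two cuts `P(o ↮ uᵢ)` likewise; the pure-real certificate `Gate3.arith_coupled`
(`(p+(1−p)r₁)(1−r₂)·(U − P(o↮u₁)) + (1−p)(1−r₁)·(U − P(o↮u₂)) ≤ 0`, two lines of algebra) closes.  The general gate (all `p, r₁, r₂`)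
needs the mean hypothesis, the outside relays and Harris' inequality (memo §4–§6; in preparation).
[cite: KozmaNitzan2024, Conjecture 3 (p. 15)] (the row served); [cite: Grimmett1999, §1.3 p. 10, §2.2]; [this work].
-/

noncomputable section

namespace Summit.CriticalPhenomena.PercolationContinuityZ3.Theorems

namespace Quant

open Finset MeasureTheory Set
open Literature.Probability.LatticeModels
open Literature.Probability.Percolation
open Bundle (offZ)
open scoped Classical

variable {n : ℕ}

namespace Gate3

/-- **The coupled-regime certificate** (pure real arithmetic).  With the laws of file III written in the off-`v` probabilities
`x = P(¬G₁∧¬G₂)`, `y₁ = P(¬G₁)`, `y₂ = P(¬G₂)`, `z = P(¬(G₁∧G₂))`, `h₁ = P(¬G₁∧¬[u₂~u₁])`, `h₂ = P(¬G₂∧¬[u₁~u₂])` and their linear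
relations, `(1−p)² ≤ (p+(1−p)r₁)(p+(1−p)r₂)` and both cuts `≤ t` give the bound `U ≤ t`. [this work] -/
theorem arith_coupled (p r₁ r₂ x y₁ y₂ z h₁ h₂ t : ℝ) (hp0 : 0 ≤ p) (hp1 : p ≤ 1) (hr10 : 0 ≤ r₁) (hr11 : r₁ ≤ 1)
    (hr20 : 0 ≤ r₂) (hr21 : r₂ ≤ 1) (hc : (1 - p) ^ 2 ≤ (p + (1 - p) * r₁) * (p + (1 - p) * r₂))
    (F1 : z ≤ y₁ + y₂ - x) (F2 : y₁ ≤ h₁ + x) (F3 : y₂ ≤ h₂ + x) (F4 : x ≤ y₁)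
    (hL1 : p * ((1 - r₁) * r₂) * h₁ + (1 - p) * (r₁ * r₂) * x +
      (p * ((1 - r₁) * (1 - r₂)) + (1 - p) * (r₁ * (1 - r₂)) + (1 - p) * ((1 - r₁) * r₂) + (1 - p) * ((1 - r₁) * (1 - r₂))) * y₁ ≤ t)
    (hL2 : p * ((1 - r₂) * r₁) * h₂ + (1 - p) * (r₂ * r₁) * x +
      (p * ((1 - r₂) * (1 - r₁)) + (1 - p) * (r₂ * (1 - r₁)) + (1 - p) * ((1 - r₂) * r₁) + (1 - p) * ((1 - r₂) * (1 - r₁))) * y₂ ≤ t) :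
    p * ((1 - r₁) * (1 - r₂)) * x + (1 - p) * (r₁ * r₂) * x + (1 - p) * (r₁ * (1 - r₂)) * y₁ + (1 - p) * ((1 - r₁) * r₂) * y₂ +
      (1 - p) * ((1 - r₁) * (1 - r₂)) * z ≤ t := by
  have h1p : 0 ≤ 1 - p := by linarith
  have h1r1 : 0 ≤ 1 - r₁ := by linarith
  have h1r2 : 0 ≤ 1 - r₂ := by linarith
  have hs1 : 0 ≤ p + (1 - p) * r₁ := by positivity
  have hs2 : 0 ≤ p + (1 - p) * r₂ := by positivity
  -- replace `z` by its upper bound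
  have hW : 0 ≤ (1 - p) * ((1 - r₁) * (1 - r₂)) := by positivity
  have hz : (1 - p) * ((1 - r₁) * (1 - r₂)) * z ≤ (1 - p) * ((1 - r₁) * (1 - r₂)) * (y₁ + y₂ - x) :=
    mul_le_mul_of_nonneg_left F1 hW
  -- the two excesses `U' − L₁`, `U' − L₂` in the type masses `b₁ = y₂ − x`, `b₂ = y₁ − x`, `aᵢ = hᵢ + x − yᵢ`
  have e1 : (p * ((1 - r₁) * (1 - r₂)) * x + (1 - p) * (r₁ * r₂) * x + (1 - p) * (r₁ * (1 - r₂)) * y₁ +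
        (1 - p) * ((1 - r₁) * r₂) * y₂ + (1 - p) * ((1 - r₁) * (1 - r₂)) * (y₁ + y₂ - x)) -
      (p * ((1 - r₁) * r₂) * h₁ + (1 - p) * (r₁ * r₂) * x +
        (p * ((1 - r₁) * (1 - r₂)) + (1 - p) * (r₁ * (1 - r₂)) + (1 - p) * ((1 - r₁) * r₂) + (1 - p) * ((1 - r₁) * (1 - r₂))) * y₁) =
      (1 - r₁) * ((1 - p) * (y₂ - x) - (p + (1 - p) * r₂) * (y₁ - x) - p * r₂ * (h₁ + x - y₁)) := by ring
  have e2 : (p * ((1 - r₁) * (1 - r₂)) * x + (1 - p) * (r₁ * r₂) * x + (1 - p) * (r₁ * (1 - r₂)) * y₁ +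
        (1 - p) * ((1 - r₁) * r₂) * y₂ + (1 - p) * ((1 - r₁) * (1 - r₂)) * (y₁ + y₂ - x)) -
      (p * ((1 - r₂) * r₁) * h₂ + (1 - p) * (r₂ * r₁) * x +
        (p * ((1 - r₂) * (1 - r₁)) + (1 - p) * (r₂ * (1 - r₁)) + (1 - p) * ((1 - r₂) * r₁) + (1 - p) * ((1 - r₂) * (1 - r₁))) * y₂) =
      (1 - r₂) * ((1 - p) * (y₁ - x) - (p + (1 - p) * r₁) * (y₂ - x) - p * r₁ * (h₂ + x - y₂)) := by ring
  -- the certificate: `α₁ (U' − L₁) + α₂ (U' − L₂) ≤ 0` with `α₁ = (p+(1−p)r₁)(1−r₂)`, `α₂ = (1−p)(1−r₁)`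
  have key : (p + (1 - p) * r₁) * (1 - r₂) * ((1 - r₁) * ((1 - p) * (y₂ - x) - (p + (1 - p) * r₂) * (y₁ - x) - p * r₂ * (h₁ + x - y₁))) +
      (1 - p) * (1 - r₁) * ((1 - r₂) * ((1 - p) * (y₁ - x) - (p + (1 - p) * r₁) * (y₂ - x) - p * r₁ * (h₂ + x - y₂))) =
      ((1 - r₁) * (1 - r₂)) * (((1 - p) ^ 2 - (p + (1 - p) * r₁) * (p + (1 - p) * r₂)) * (y₁ - x) -
        (p + (1 - p) * r₁) * p * r₂ * (h₁ + x - y₁) - (1 - p) * p * r₁ * (h₂ + x - y₂)) := by ring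
  have hin : ((1 - p) ^ 2 - (p + (1 - p) * r₁) * (p + (1 - p) * r₂)) * (y₁ - x) -
      (p + (1 - p) * r₁) * p * r₂ * (h₁ + x - y₁) - (1 - p) * p * r₁ * (h₂ + x - y₂) ≤ 0 := by
    have t1 : ((1 - p) ^ 2 - (p + (1 - p) * r₁) * (p + (1 - p) * r₂)) * (y₁ - x) ≤ 0 :=
      mul_nonpos_of_nonpos_of_nonneg (by linarith) (by linarith)
    have t2 : 0 ≤ (p + (1 - p) * r₁) * p * r₂ * (h₁ + x - y₁) := mul_nonneg (by positivity) (by linarith)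
    have t3 : 0 ≤ (1 - p) * p * r₁ * (h₂ + x - y₂) := mul_nonneg (by positivity) (by linarith)
    linarith
  have hneg : (p + (1 - p) * r₁) * (1 - r₂) * ((1 - r₁) * ((1 - p) * (y₂ - x) - (p + (1 - p) * r₂) * (y₁ - x) - p * r₂ * (h₁ + x - y₁))) +
      (1 - p) * (1 - r₁) * ((1 - r₂) * ((1 - p) * (y₁ - x) - (p + (1 - p) * r₁) * (y₂ - x) - p * r₁ * (h₂ + x - y₂))) ≤ 0 := by
    rw [key]
    exact mul_nonpos_of_nonneg_of_nonpos (mul_nonneg h1r1 h1r2) hin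
  have hα1 : 0 ≤ (p + (1 - p) * r₁) * (1 - r₂) := mul_nonneg hs1 h1r2
  have hα2 : 0 ≤ (1 - p) * (1 - r₁) := mul_nonneg h1p h1r1
  rw [← e1, ← e2] at hneg
  by_cases hα : 0 < (p + (1 - p) * r₁) * (1 - r₂) + (1 - p) * (1 - r₁)
  · -- `(α₁ + α₂)·U' ≤ α₁ L₁ + α₂ L₂ ≤ (α₁ + α₂)·t`
    have h1 : ((p + (1 - p) * r₁) * (1 - r₂) + (1 - p) * (1 - r₁)) *
        (p * ((1 - r₁) * (1 - r₂)) * x + (1 - p) * (r₁ * r₂) * x + (1 - p) * (r₁ * (1 - r₂)) * y₁ +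
          (1 - p) * ((1 - r₁) * r₂) * y₂ + (1 - p) * ((1 - r₁) * (1 - r₂)) * (y₁ + y₂ - x)) ≤
        ((p + (1 - p) * r₁) * (1 - r₂) + (1 - p) * (1 - r₁)) * t := by
      have a1 := mul_le_mul_of_nonneg_left hL1 hα1
      have a2 := mul_le_mul_of_nonneg_left hL2 hα2
      linarith [a1, a2, hneg]
    have h2 := le_of_mul_le_mul_left h1 hα
    linarith [h2, hz]
  · -- `α₂ = 0`: then `U' ≤ L₁` directly
    have hα2z : (1 - p) * (1 - r₁) = 0 := by linarith
    have h3 : (1 - r₁) * ((1 - p) * (y₂ - x) - (p + (1 - p) * r₂) * (y₁ - x) - p * r₂ * (h₁ + x - y₁)) ≤ 0 := by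
      have e3 : (1 - r₁) * ((1 - p) * (y₂ - x) - (p + (1 - p) * r₂) * (y₁ - x) - p * r₂ * (h₁ + x - y₁)) =
          (1 - p) * (1 - r₁) * (y₂ - x) - (1 - r₁) * ((p + (1 - p) * r₂) * (y₁ - x) + p * r₂ * (h₁ + x - y₁)) := by ring
      rw [e3, hα2z, zero_mul, zero_sub, neg_nonpos]
      have t1 : 0 ≤ (p + (1 - p) * r₂) * (y₁ - x) := mul_nonneg hs2 (by linarith)
      have t2 : 0 ≤ p * r₂ * (h₁ + x - y₁) := mul_nonneg (mul_nonneg hp0 hr20) (by linarith)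
      exact mul_nonneg h1r1 (by linarith)
    rw [← e1] at h3
    linarith [h3, hz, hL1]

end Gate3

/-- **FAR at layer one for a COUPLED degree-three gate at the observer.**  If `v ∈ A` has positive weight only on `s(o,v)` (`p`),
`s(v,u₁)` (`r₁`), `s(v,u₂)` (`r₂`) for relays `u₁, u₂ ∈ A` (all of `o, v, u₁, u₂` distinct) and `(1 − p)² ≤ (p + (1−p)r₁)(p + (1−p)r₂)`,
then `P(o ↮ u₁) ≤ t` and `P(o ↮ u₂) ≤ t` imply `P(#{a ∈ A : o ↔ a} ≤ 1) ≤ t` — no mean hypothesis needed. [this work] -/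
theorem farLayerOne_of_gate3_coupled (w : Sym2 (Fin n) → unitInterval) (A : Finset (Fin n)) {o v u₁ u₂ : Fin n}
    (hov : o ≠ v) (h1v : u₁ ≠ v) (h2v : u₂ ≠ v) (ho1 : o ≠ u₁) (ho2 : o ≠ u₂) (h12 : u₁ ≠ u₂)
    (hvA : v ∈ A) (h1A : u₁ ∈ A) (h2A : u₂ ∈ A)
    (hw : ∀ z : Fin n, z ≠ o → z ≠ u₁ → z ≠ u₂ → z ≠ v → (w s(v, z) : ℝ) = 0)
    (hc : (1 - (w s(o, v) : ℝ)) ^ 2 ≤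
      ((w s(o, v) : ℝ) + (1 - w s(o, v)) * w s(v, u₁)) * ((w s(o, v) : ℝ) + (1 - w s(o, v)) * w s(v, u₂)))
    (t : ℝ) (hcut₁ : (prodBernoulli w).real (openConn o u₁ : Set (BondConfig (Fin n)))ᶜ ≤ t)
    (hcut₂ : (prodBernoulli w).real (openConn o u₂ : Set (BondConfig (Fin n)))ᶜ ≤ t) :
    (prodBernoulli w).real {ω : BondConfig (Fin n) | (A.filter fun a => ω ∈ openConn o a).card ≤ 1} ≤ t := by
  set μ := prodBernoulli w with hμ
  have hp0 : 0 ≤ (w s(o, v) : ℝ) := (w s(o, v)).2.1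
  have hp1 : (w s(o, v) : ℝ) ≤ 1 := (w s(o, v)).2.2
  have hr10 : 0 ≤ (w s(v, u₁) : ℝ) := (w s(v, u₁)).2.1
  have hr11 : (w s(v, u₁) : ℝ) ≤ 1 := (w s(v, u₁)).2.2
  have hr20 : 0 ≤ (w s(v, u₂) : ℝ) := (w s(v, u₂)).2.1
  have hr21 : (w s(v, u₂) : ℝ) ≤ 1 := (w s(v, u₂)).2.2
  -- the laws (file III)
  have hN := Gate3.real_card_le_one_le w hw hov h1v h2v ho1 ho2 h12 A hvA h1A h2A
  have hL1 := Gate3.real_compl_openConn_u₁_eq (v := v) w hw hov h1v h2v ho1 ho2 h12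
  have hL2 := Gate3.real_compl_openConn_u₂_eq (v := v) w hw hov h1v h2v ho1 ho2 h12
  -- the linear relations among the off-`v` events
  have F1 := Gate3.real_offv_incl_excl (o := o) (v := v) (u₁ := u₁) (u₂ := u₂) μ
  have F2 := Gate3.real_offv_cover₁ (o := o) (v := v) (u₁ := u₁) (u₂ := u₂) μ
  have F3 := Gate3.real_offv_cover₂ (o := o) (v := v) (u₁ := u₁) (u₂ := u₂) μ
  have F4 := Gate3.real_offv_mono₁ (o := o) (v := v) (u₁ := u₁) (u₂ := u₂) μ
  rw [hL1] at hcut₁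
  rw [hL2] at hcut₂
  have key := Gate3.arith_coupled (w s(o, v) : ℝ) (w s(v, u₁)) (w s(v, u₂))
    (μ.real {ω : BondConfig (Fin n) | ¬ (openGraph (offZ {v} ω)).Reachable o u₁ ∧ ¬ (openGraph (offZ {v} ω)).Reachable o u₂})
    (μ.real {ω : BondConfig (Fin n) | ¬ (openGraph (offZ {v} ω)).Reachable o u₁})
    (μ.real {ω : BondConfig (Fin n) | ¬ (openGraph (offZ {v} ω)).Reachable o u₂})
    (μ.real {ω : BondConfig (Fin n) | ¬ ((openGraph (offZ {v} ω)).Reachable o u₁ ∧ (openGraph (offZ {v} ω)).Reachable o u₂)})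
    (μ.real {ω : BondConfig (Fin n) | ¬ (openGraph (offZ {v} ω)).Reachable o u₁ ∧ ¬ (openGraph (offZ {v} ω)).Reachable u₂ u₁})
    (μ.real {ω : BondConfig (Fin n) | ¬ (openGraph (offZ {v} ω)).Reachable o u₂ ∧ ¬ (openGraph (offZ {v} ω)).Reachable u₁ u₂})
    t hp0 hp1 hr10 hr11 hr20 hr21 hc (le_of_eq F1) F2 F3 F4 (by linarith [hcut₁]) (by linarith [hcut₂])
  linarith [hN, key]

/-- The same with the cut hypothesis of `Quant.FarRelayRow` (all relays), still without the mean hypothesis. [this work] -/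
theorem farLayerOne_of_gate3_coupled' (w : Sym2 (Fin n) → unitInterval) (A : Finset (Fin n)) {o v u₁ u₂ : Fin n}
    (hov : o ≠ v) (h1v : u₁ ≠ v) (h2v : u₂ ≠ v) (ho1 : o ≠ u₁) (ho2 : o ≠ u₂) (h12 : u₁ ≠ u₂)
    (hvA : v ∈ A) (h1A : u₁ ∈ A) (h2A : u₂ ∈ A)
    (hw : ∀ z : Fin n, z ≠ o → z ≠ u₁ → z ≠ u₂ → z ≠ v → (w s(v, z) : ℝ) = 0)
    (hc : (1 - (w s(o, v) : ℝ)) ^ 2 ≤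
      ((w s(o, v) : ℝ) + (1 - w s(o, v)) * w s(v, u₁)) * ((w s(o, v) : ℝ) + (1 - w s(o, v)) * w s(v, u₂)))
    (t : ℝ) (hcut : ∀ a ∈ A, (prodBernoulli w).real (openConn o a : Set (BondConfig (Fin n)))ᶜ ≤ t) :
    (prodBernoulli w).real {ω : BondConfig (Fin n) | (A.filter fun a => ω ∈ openConn o a).card ≤ 1} ≤ t :=
  farLayerOne_of_gate3_coupled w A hov h1v h2v ho1 ho2 h12 hvA h1A h2A hw hc t (hcut u₁ h1A) (hcut u₂ h2A)

/-- **The half-glued gate**: if `p = w s(o,v) ≥ 1/2` the gate is coupled, so FAR(1) holds at `(w, A, o)` (cut hypothesis only).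
[this work] -/
theorem farLayerOne_of_gate3_half (w : Sym2 (Fin n) → unitInterval) (A : Finset (Fin n)) {o v u₁ u₂ : Fin n}
    (hov : o ≠ v) (h1v : u₁ ≠ v) (h2v : u₂ ≠ v) (ho1 : o ≠ u₁) (ho2 : o ≠ u₂) (h12 : u₁ ≠ u₂)
    (hvA : v ∈ A) (h1A : u₁ ∈ A) (h2A : u₂ ∈ A)
    (hw : ∀ z : Fin n, z ≠ o → z ≠ u₁ → z ≠ u₂ → z ≠ v → (w s(v, z) : ℝ) = 0)
    (hp : (1 : ℝ) / 2 ≤ w s(o, v))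
    (t : ℝ) (hcut : ∀ a ∈ A, (prodBernoulli w).real (openConn o a : Set (BondConfig (Fin n)))ᶜ ≤ t) :
    (prodBernoulli w).real {ω : BondConfig (Fin n) | (A.filter fun a => ω ∈ openConn o a).card ≤ 1} ≤ t := by
  refine farLayerOne_of_gate3_coupled' w A hov h1v h2v ho1 ho2 h12 hvA h1A h2A hw ?_ t hcut
  have hp1 : (w s(o, v) : ℝ) ≤ 1 := (w s(o, v)).2.2
  have hr10 : 0 ≤ (w s(v, u₁) : ℝ) := (w s(v, u₁)).2.1
  have hr20 : 0 ≤ (w s(v, u₂) : ℝ) := (w s(v, u₂)).2.1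
  have h1 : (w s(o, v) : ℝ) ≤ (w s(o, v) : ℝ) + (1 - w s(o, v)) * w s(v, u₁) := by nlinarith
  have h2 : (w s(o, v) : ℝ) ≤ (w s(o, v) : ℝ) + (1 - w s(o, v)) * w s(v, u₂) := by nlinarith
  have h3 : (1 - (w s(o, v) : ℝ)) ^ 2 ≤ (w s(o, v) : ℝ) * w s(o, v) := by nlinarith
  calc (1 - (w s(o, v) : ℝ)) ^ 2 ≤ (w s(o, v) : ℝ) * w s(o, v) := h3
    _ ≤ ((w s(o, v) : ℝ) + (1 - w s(o, v)) * w s(v, u₁)) * ((w s(o, v) : ℝ) + (1 - w s(o, v)) * w s(v, u₂)) :=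
        mul_le_mul h1 h2 (by linarith) (by linarith)

/-- The row form: a coupled degree-three gate at the observer gives the layer-one instance (`j = 1`) of `Quant.FarRelayRow` at
`(w, A, o)` (the mean hypothesis is carried but not used). [this work] -/
theorem farRelayRow_one_of_gate3_coupled (w : Sym2 (Fin n) → unitInterval) (A : Finset (Fin n)) {o v u₁ u₂ : Fin n}
    (hov : o ≠ v) (h1v : u₁ ≠ v) (h2v : u₂ ≠ v) (ho1 : o ≠ u₁) (ho2 : o ≠ u₂) (h12 : u₁ ≠ u₂)
    (hvA : v ∈ A) (h1A : u₁ ∈ A) (h2A : u₂ ∈ A)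
    (hw : ∀ z : Fin n, z ≠ o → z ≠ u₁ → z ≠ u₂ → z ≠ v → (w s(v, z) : ℝ) = 0)
    (hc : (1 - (w s(o, v) : ℝ)) ^ 2 ≤
      ((w s(o, v) : ℝ) + (1 - w s(o, v)) * w s(v, u₁)) * ((w s(o, v) : ℝ) + (1 - w s(o, v)) * w s(v, u₂)))
    (t : ℝ) (_hEN : (2 * (1 : ℕ) : ℝ) < ∑ a ∈ A, (prodBernoulli w).real (openConn o a))
    (hcut : ∀ a ∈ A, (prodBernoulli w).real (openConn o a : Set (BondConfig (Fin n)))ᶜ ≤ t) :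
    (prodBernoulli w).real {ω : BondConfig (Fin n) | (A.filter fun a => ω ∈ openConn o a).card ≤ 1} ≤ t :=
  farLayerOne_of_gate3_coupled' w A hov h1v h2v ho1 ho2 h12 hvA h1A h2A hw hc t hcut

end Quant

end Summit.CriticalPhenomena.PercolationContinuityZ3.Theorems
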